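import Mathlib
import Literature.NumberTheory.LFunctions.Zhang2022.Section15ResidueDischarge
import Literature.NumberTheory.LFunctions.Zhang2022.Section15RhoProductsRel
import HarnessLib

/-!
# Zhang (2022) §15 p. 88: the residue nodes at the canonical instantiation `inputs15AB`, and (15.24)
# from three displays

Topic `Literature/NumberTheory/LFunctions/Zhang2022` (Landau–Siegel audit tree; verdict-neutral).
Y. Zhang, *Discrete mean estimates and the Landau–Siegel zero*, arXiv:2211.02515v1 (2022)
[Zhang2022LandauSiegel] — **an unrefereed manuscript under adjudication** (cell siegel-zhang, D-0069
width campaign). DISCHARGE file (theorems only; no new definitions, no new facts); no statement about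
Theorems 1–2 of the manuscript or about Landau–Siegel zeros is made or implied.

* `calR1_rel_all` — the surviving RELATIVE form of `Z22:§15.u059` [Z22 p.88, tex L4380–L4382] for all
  three `j` at once, in the `β_{j+1}, β_{j+2}` indexing of the typed node and in the exact shape consumed by
  `Ded1524.eval1524_of_displays_rel` (sz-d47, `Section15RhoProductsRel`):
  `‖ℛ₁ⱼ − M₁ⱼ‖ ≤ C‖M₁ⱼ‖𝓛⁻⁶`, `M₁ⱼ = P₄^{β₃−βⱼ}/((β_{j+1}−βⱼ)(β_{j+2}−βⱼ)L′(1,χ))`, unconditionally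
  under (A), for the concrete `Typed.Section15B.calR1`.
* `step15_u058_inputs15AB`, `step15_u060_inputs15AB`, `step15_u061_inputs15AB`, `step15_u062_inputs15AB`:
  the typed nodes `Z22:§15.u058`, `u060`–`u062` HOLD at the landed canonical instantiation
  `Typed.Section15C.inputs15AB` (fields = the landed §15A/§15B objects), no hypothesis left
  (Lemma 5.4 = tree `Skeleton.lemma54_holds`).
* `eval1524_of_three_displays` — **(15.24) = `Skeleton.Eval1524 c′` from the three displayed §15 claims
  (15.6), (15.17), (15.23) alone**, composing sz-d47's `Ded1524.eval1524_of_displays_rel` with the two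
  residue inputs proved here.
-/

noncomputable section

open Complex Real Filter Topology

namespace Literature.NumberTheory.LFunctions.Zhang2022.ResidueValues

open Skeleton Typed Typed.Section15B Typed.Section15C

variable (c' : ℝ)

/-- **`Z22:§15.u059`, surviving relative form, all `j`** (the shape consumed by
`Ded1524.eval1524_of_displays_rel`). [cite: Zhang2022LandauSiegel, §15 p. 88] -/
theorem calR1_rel_all : ∃ C : ℝ, ForAllLarge fun D _ χ => AssumptionA D χ → ∀ j ∈ ({1, 2, 3} : Finset ℕ),
    ‖Section15B.calR1 c' χ j - ((P4 D : ℝ) : ℂ) ^ (beta3 c' D - betaJ c' D j) /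
        ((betaJ c' D (j + 1) - betaJ c' D j) * (betaJ c' D (j + 2) - betaJ c' D j) *
          deriv χ.LFunction 1)‖ ≤
      C * ‖((P4 D : ℝ) : ℂ) ^ (beta3 c' D - betaJ c' D j) /
        ((betaJ c' D (j + 1) - betaJ c' D j) * (betaJ c' D (j + 2) - betaJ c' D j) *
          deriv χ.LFunction 1)‖ / ell D ^ 6 := by
  obtain ⟨C₁, _, h1⟩ := calR1_one_rel c'
  obtain ⟨C₂, _, h2⟩ := calR1_two_rel c'
  obtain ⟨C₃, _, h3⟩ := calR1_three_rel c'
  obtain ⟨D₀, hall⟩ := (h1.and h2).and h3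
  refine ⟨max C₁ (max C₂ C₃), D₀, fun D _ χ hD hq hp hA j hj => ?_⟩
  obtain ⟨⟨g1, g2⟩, g3⟩ := hall D χ hD hq hp
  simp only [Finset.mem_insert, Finset.mem_singleton] at hj
  rcases hj with rfl | rfl | rfl
  · show ‖Section15B.calR1 c' χ 1 - ((P4 D : ℝ) : ℂ) ^ (beta3 c' D - betaJ c' D 1) /
        ((betaJ c' D 2 - betaJ c' D 1) * (betaJ c' D 3 - betaJ c' D 1) * deriv χ.LFunction 1)‖ ≤
      max C₁ (max C₂ C₃) * ‖((P4 D : ℝ) : ℂ) ^ (beta3 c' D - betaJ c' D 1) /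
        ((betaJ c' D 2 - betaJ c' D 1) * (betaJ c' D 3 - betaJ c' D 1) * deriv χ.LFunction 1)‖ /
          ell D ^ 6
    rw [betaJ_one, betaJ_two, betaJ_three]
    refine (g1 hA).trans ?_
    rw [div_mul_eq_mul_div]
    gcongr
    exact le_max_left _ _
  · show ‖Section15B.calR1 c' χ 2 - ((P4 D : ℝ) : ℂ) ^ (beta3 c' D - betaJ c' D 2) /
        ((betaJ c' D 3 - betaJ c' D 2) * (betaJ c' D 4 - betaJ c' D 2) * deriv χ.LFunction 1)‖ ≤
      max C₁ (max C₂ C₃) * ‖((P4 D : ℝ) : ℂ) ^ (beta3 c' D - betaJ c' D 2) /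
        ((betaJ c' D 3 - betaJ c' D 2) * (betaJ c' D 4 - betaJ c' D 2) * deriv χ.LFunction 1)‖ /
          ell D ^ 6
    rw [betaJ_two, betaJ_three, betaJ_four]
    refine (g2 hA).trans ?_
    rw [div_mul_eq_mul_div]
    gcongr
    exact le_trans (le_max_left _ _) (le_max_right _ _)
  · show ‖Section15B.calR1 c' χ 3 - ((P4 D : ℝ) : ℂ) ^ (beta3 c' D - betaJ c' D 3) /
        ((betaJ c' D 4 - betaJ c' D 3) * (betaJ c' D 5 - betaJ c' D 3) * deriv χ.LFunction 1)‖ ≤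
      max C₁ (max C₂ C₃) * ‖((P4 D : ℝ) : ℂ) ^ (beta3 c' D - betaJ c' D 3) /
        ((betaJ c' D 4 - betaJ c' D 3) * (betaJ c' D 5 - betaJ c' D 3) * deriv χ.LFunction 1)‖ /
          ell D ^ 6
    rw [betaJ_three, betaJ_four, betaJ_five]
    refine (g3 hA).trans ?_
    rw [div_mul_eq_mul_div]
    gcongr
    exact le_trans (le_max_right _ _) (le_max_right _ _)

/-! ## The nodes at the canonical instantiation `Typed.Section15C.inputs15AB` -/

/-- **`Z22:§15.u058` HOLDS at `inputs15AB`** (`ℛ₁* = Typed.Section15A.calR1star`).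
[cite: Zhang2022LandauSiegel, §15 p. 88] -/
theorem step15_u058_inputs15AB : Step15_u058 c' Section15C.inputs15AB :=
  step15_u058_holds c' Section15C.inputs15AB (fun _ _ _ => rfl)

/-- **`Z22:§15.u060` HOLDS at `inputs15AB`**: `ℛ₁*ℛ₁₁ = 1 + O(1/𝓛)`. [cite: Zhang2022LandauSiegel, §15 p. 88] -/
theorem step15_u060_inputs15AB : Step15_u060 c' Section15C.inputs15AB :=
  step15_u060_holds c' Section15C.inputs15AB (fun _ _ _ => rfl) (fun _ _ _ _ => rfl)

/-- **`Z22:§15.u061` HOLDS at `inputs15AB`**: `ℛ₁*ℛ₁₂ = 2 + O(1/𝓛)`. [cite: Zhang2022LandauSiegel, §15 p. 88] -/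
theorem step15_u061_inputs15AB : Step15_u061 c' Section15C.inputs15AB :=
  step15_u061_holds c' Section15C.inputs15AB (fun _ _ _ => rfl) (fun _ _ _ _ => rfl)

/-- **`Z22:§15.u062` HOLDS at `inputs15AB`**: `ℛ₁*ℛ₁₃ = 1 + O(1/𝓛)`. [cite: Zhang2022LandauSiegel, §15 p. 88] -/
theorem step15_u062_inputs15AB : Step15_u062 c' Section15C.inputs15AB :=
  step15_u062_holds c' Section15C.inputs15AB (fun _ _ _ => rfl) (fun _ _ _ _ => rfl)

/-- The same four at the χ-absorbed instantiation `inputs15ABchi` (its `ℛ₁*`, `ℛ₁ⱼ` fields coincide with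
those of `inputs15AB`). [cite: Zhang2022LandauSiegel, §15 p. 88] -/
theorem step15_u058_u06x_inputs15ABchi :
    Step15_u058 c' Section15C.inputs15ABchi ∧ Step15_u060 c' Section15C.inputs15ABchi ∧
      Step15_u061 c' Section15C.inputs15ABchi ∧ Step15_u062 c' Section15C.inputs15ABchi :=
  ⟨step15_u058_holds c' _ (fun _ _ _ => rfl),
    step15_u060_holds c' _ (fun _ _ _ => rfl) (fun _ _ _ _ => rfl),
    step15_u061_holds c' _ (fun _ _ _ => rfl) (fun _ _ _ _ => rfl),
    step15_u062_holds c' _ (fun _ _ _ => rfl) (fun _ _ _ _ => rfl)⟩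

/-! ## (15.24) from the three §15 displays (15.6), (15.17), (15.23) -/

/-- **(15.24) ⇐ (15.6) ∧ (15.17) ∧ (15.23)** (`Skeleton.Eval1524 c′`, "`Φ₁ = (𝔢₁+2𝔢₂+𝔢₃)𝔞𝔓 + o(𝔓)`",
§15 p. 88, tex L4394–L4396): sz-d47's `Ded1524.eval1524_of_displays_rel` with its two residue inputs
(u058 and the relative u059) now PROVED (`step15_u058_inputs15AB`, `calR1_rel_all`). The three remaining
hypotheses are the typed displays `Section15A.Eq15_6`, `Section15B.Eq15_17`, `Section15C.Eq15_23` at the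
printed reading `bLit`/`inputs15AB`. [cite: Zhang2022LandauSiegel, §15 (15.24) p. 88] -/
theorem eval1524_of_three_displays (h6 : Section15A.Eq15_6 c' Section15A.bLit)
    (h17 : Section15B.Eq15_17 c' Section15A.bLit) (h23 : Section15C.Eq15_23 c' Section15C.inputs15AB) :
    Eval1524 c' :=
  Ded1524.eval1524_of_displays_rel c' h6 h17 h23 (step15_u058_inputs15AB c') (calR1_rel_all c')

end Literature.NumberTheory.LFunctions.Zhang2022.ResidueValues
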